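import Summits.QuantumFields.BalabanUV.T4Continuum.Support.VariationalVectorFeynmanForm
import Summits.QuantumFields.BalabanUV.T4Continuum.Support.VariationalVectorAverage

/-!
# T⁴ programme, spine node NE2 (U1a), lane P2 — SUPPLIER ITEM «V-REG FEYNMAN, GENERAL `E`», file 2∕3: `Σ‖(½curl†curl + D div)W‖² ≤ (Λ∕n^d)·F(W)` AT A
# CONSTRAINED MINIMISER of the Feynman action `F = curlSq∕2 + divSq` on a fibre of the line-indexed average `QvL T`, by UB⁺-DUALITY — with NO
# multiplier structure (the UB⁺ competitor for the datum `QvL T (elV W)` is subtracted from `elV W` to produce a kernel test field)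
# (function world, general finite-dimensional Hilbert `E`; the complement of leaf-03-g5's «V-REG PROPER» matrix-world chain — the same lemma in
# matrix letters is their `VariationalGradientDuality.nsq_mulVec_le_of_isMin` — filed at their request, CLAIMS.log l.15496)

NE2 formalisation swarm `b2b-balaban-t4-ne2-formalise-*`, leaf prover 02 (gen 5); register P2-sup (V-REG PROPER = leaf-03-g5, l.15022; this = its general-`E`
Feynman-inhabitant complement, l.15432 ∕ l.15496).  Over file 1 (`VariationalVectorFeynmanForm`:
`ipvV`, `elV`, `bformV`, `ipvV_elV`, `ipvV_elV_eq_zero_of_isMin`, `QvL_add_smul`) and leaf-01-g5's `VariationalVectorAverage.nsqV_QvL_le_qWV`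
(p218350: `Σ‖QvL T W‖² ≤ n^{−d}·Σ‖W‖²` for contractive line transports) BY NAME:
 * §1 Cauchy–Schwarz for the Feynman form `‖bformV V W‖² ≤ F(V)·F(W)` (`norm_bformV_sq_le`; one `Finset.sum_mul_sq_le_sq_mul_sq` over the
   disjoint union of the plaquette and site index sets, weights `½` and `1`);
 * §2 **`nsqV_elV_le_of_isMin`**: at a minimiser `W` of the Feynman inhabitant `ScV R (landauG 1 R)` on `{W₂ : QvL T W₂ = φ}`, for every UB⁺-type
   constant `Λ` of the binder `hUB : ∀ ν, ∃ λ, QvL T λ = ν ∧ F λ ≤ Λ·Σ‖ν‖²` (lattice units; the shape V-UB-L supplies, NOT discharged here),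

     `Σ_{x,ν} ‖(elV R W)(x,ν)‖² ≤ (Λ∕n^d)·F(W)`.

   PROOF (no Euler–Lagrange multiplier, no block structure of `ker QvL T`): put `P := elV W`, take the competitor `λ` for the datum `QvL T P`; then
   `P − λ ∈ ker QvL T`, so file 1's first variation gives `⟨P − λ, P⟩ = 0`, i.e. `Σ‖P‖² = ⟨λ, P⟩ = bformV λ W ≤ √(F λ·F W) ≤ √(Λ·Σ‖QvL T P‖²·F W)
   ≤ √(Λ·n^{−d}·Σ‖P‖²·F W)`.  Only `‖T‖ ≤ 1` is used (no unitarity of the line transports).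
File 3∕3 (`VariationalVectorFeynmanRegularityRho`): physical units + leaf-09-g6's vector Bochner `sum_hessv_le_el` + Weitzenböck ⟹ the `hREG` binder of
`vector_pair_bracket_sqrt` for `ρ := rhoV`, `G := landauG 1`.

HONEST FRAMING (T4-DAG p. 1).  Model level: bond operators `R`, line transports `T` (contractions) DATA; Feynman inhabitant `G = landauG 1 R` of the
road's DATA slot (V-GF open — nothing decided here).  Elementary, [folklore]; nothing printed is a hypothesis; no `def … : Prop`; no `sorry`; axioms
standard.  NE2 NOT proved; spine PROVED 0∕9; rung (B)+1 finite T⁴ — NOT infinite volume, NOT a mass gap, NOT Clay.  HONEST DEPENDENCY (cell, verbatim):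
continuum YM on T⁴ ⇐ BetaPertH ∧ nine spine estimates (0/9 proved); BetaPertH ⇐ (D1) ∧ (D4) ∧ CAP+tail; G-an2-4 gates asym, D1 and NE2/3/4.
-/

noncomputable section

namespace Summit.QuantumFields.BalabanUV.T4Continuum.VariationalVectorFeynmanRegularity

open Finset
open scoped InnerProductSpace ComplexConjugate
open Literature.MathematicalPhysics.QuantumFieldTheory.Balaban1983to89.B5Prop11Plancherel (Tor fine unitVec)
open Summit.QuantumFields.BalabanUV.T4Continuum.VariationalColourBochner (ipv norm_ipv_le)
open Summit.QuantumFields.BalabanUV.T4Continuum.VectorBlockTrialForm (nsqV nsqV_nonneg QvL)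
open Summit.QuantumFields.BalabanUV.T4Continuum.VariationalVectorForm (curlV curlSq curlSq_nonneg ScV qWV)
open Summit.QuantumFields.BalabanUV.T4Continuum.VariationalVectorWeitzenbock (divV divSq divSq_nonneg)
open Summit.QuantumFields.BalabanUV.T4Continuum.VariationalVectorGarding (landauG)
open Summit.QuantumFields.BalabanUV.T4Continuum.VariationalVectorAverage (nsqV_QvL_le_qWV)
open Summit.QuantumFields.BalabanUV.T4Continuum.VariationalVectorFeynmanForm
  (ipvV ipvV_self ipvV_sub_left elV bformV ipvV_elV ipvV_elV_eq_zero_of_isMin QvL_add_smul)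

variable {d : ℕ} {E : Type*} [NormedAddCommGroup E] [InnerProductSpace ℂ E] [CompleteSpace E]

/-! ## §1 Cauchy–Schwarz for the Feynman form -/

section CS

variable (N : Fin d → ℕ) [∀ μ, NeZero (N μ)]

omit [CompleteSpace E] in
/-- the curl form over the flat plaquette index. [folklore] -/
theorem curlSq_eq_sum_prod (R : Tor N → Fin d → (E →L[ℂ] E)) (W : Tor N → Fin d → E) :
    curlSq N R W = ∑ p : Tor N × Fin d × Fin d, ‖curlV N R W p.1 p.2.1 p.2.2‖ ^ 2 := by
  unfold curlSq
  rw [Fintype.sum_prod_type]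
  exact sum_congr rfl fun x _ => by rw [Fintype.sum_prod_type]

omit [CompleteSpace E] in
/-- the plaquette part of the Feynman form is dominated termwise. [folklore] -/
theorem norm_curl_part_le (R : Tor N → Fin d → (E →L[ℂ] E)) (V W : Tor N → Fin d → E) :
    ‖∑ μ, ∑ ν, ipv N (fun y => curlV N R V y μ ν) (fun y => curlV N R W y μ ν)‖
      ≤ ∑ p : Tor N × Fin d × Fin d, ‖curlV N R V p.1 p.2.1 p.2.2‖ * ‖curlV N R W p.1 p.2.1 p.2.2‖ := by
  have h1 : ‖∑ μ, ∑ ν, ipv N (fun y => curlV N R V y μ ν) (fun y => curlV N R W y μ ν)‖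
      ≤ ∑ μ, ∑ ν, ∑ x, ‖curlV N R V x μ ν‖ * ‖curlV N R W x μ ν‖ :=
    (norm_sum_le _ _).trans (sum_le_sum fun μ _ => (norm_sum_le _ _).trans (sum_le_sum fun ν _ => norm_ipv_le N _ _))
  refine h1.trans (le_of_eq ?_)
  have e2 : (∑ μ, ∑ ν, ∑ x, ‖curlV N R V x μ ν‖ * ‖curlV N R W x μ ν‖)
      = ∑ x, ∑ μ, ∑ ν, ‖curlV N R V x μ ν‖ * ‖curlV N R W x μ ν‖ := by
    calc (∑ μ, ∑ ν, ∑ x, ‖curlV N R V x μ ν‖ * ‖curlV N R W x μ ν‖)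
        = ∑ μ, ∑ x, ∑ ν, ‖curlV N R V x μ ν‖ * ‖curlV N R W x μ ν‖ := sum_congr rfl fun μ _ => Finset.sum_comm
      _ = _ := Finset.sum_comm
  rw [e2, Fintype.sum_prod_type]
  exact sum_congr rfl fun x _ => by rw [Fintype.sum_prod_type]

/-- **CAUCHY–SCHWARZ FOR THE FEYNMAN FORM**: `‖bformV V W‖² ≤ F(V)·F(W)`, `F = curlSq∕2 + divSq`. [folklore] -/
theorem norm_bformV_sq_le (R : Tor N → Fin d → (E →L[ℂ] E)) (V W : Tor N → Fin d → E) :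
    ‖bformV N R V W‖ ^ 2 ≤ (curlSq N R V / 2 + divSq N R V) * (curlSq N R W / 2 + divSq N R W) := by
  -- one Cauchy–Schwarz over the disjoint union of the plaquette index (weight ½) and the site index (weight 1)
  set r : ℝ := Real.sqrt (1 / 2) with hr
  have hr2 : r * r = 1 / 2 := by rw [hr, ← Real.sqrt_mul (by norm_num), Real.sqrt_mul_self (by norm_num)]
  let F : (Tor N × Fin d × Fin d) ⊕ Tor N → ℝ := fun i => match i with
    | Sum.inl p => r * ‖curlV N R V p.1 p.2.1 p.2.2‖
    | Sum.inr x => ‖divV N R V x‖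
  let G : (Tor N × Fin d × Fin d) ⊕ Tor N → ℝ := fun i => match i with
    | Sum.inl p => r * ‖curlV N R W p.1 p.2.1 p.2.2‖
    | Sum.inr x => ‖divV N R W x‖
  have hFG : ∑ i, F i * G i = (1 / 2) * ∑ p : Tor N × Fin d × Fin d, ‖curlV N R V p.1 p.2.1 p.2.2‖ * ‖curlV N R W p.1 p.2.1 p.2.2‖
      + ∑ x, ‖divV N R V x‖ * ‖divV N R W x‖ := by
    rw [Fintype.sum_sum_type, Finset.mul_sum]
    congr 1
    exact sum_congr rfl fun p _ => by
      show r * ‖curlV N R V p.1 p.2.1 p.2.2‖ * (r * ‖curlV N R W p.1 p.2.1 p.2.2‖) = _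
      rw [← hr2]; ring
  have hFF : ∑ i, F i ^ 2 = curlSq N R V / 2 + divSq N R V := by
    rw [Fintype.sum_sum_type, curlSq_eq_sum_prod, Finset.sum_div]
    congr 1
    exact sum_congr rfl fun p _ => by
      show (r * ‖curlV N R V p.1 p.2.1 p.2.2‖) ^ 2 = _
      rw [mul_pow, show r ^ 2 = 1 / 2 by rw [sq, hr2]]; ring
  have hGG : ∑ i, G i ^ 2 = curlSq N R W / 2 + divSq N R W := by
    rw [Fintype.sum_sum_type, curlSq_eq_sum_prod, Finset.sum_div]
    congr 1
    exact sum_congr rfl fun p _ => by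
      show (r * ‖curlV N R W p.1 p.2.1 p.2.2‖) ^ 2 = _
      rw [mul_pow, show r ^ 2 = 1 / 2 by rw [sq, hr2]]; ring
  have h1 : ‖bformV N R V W‖ ≤ ∑ i, F i * G i := by
    rw [hFG]
    unfold bformV
    refine (norm_add_le _ _).trans (add_le_add ?_ (norm_ipv_le N _ _))
    rw [norm_mul, show ‖(1 / 2 : ℂ)‖ = 1 / 2 by norm_num]
    exact mul_le_mul_of_nonneg_left (norm_curl_part_le N R V W) (by norm_num)
  have h2 := Finset.sum_mul_sq_le_sq_mul_sq (Finset.univ) F G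
  rw [hFF, hGG] at h2
  exact (pow_le_pow_left₀ (norm_nonneg _) h1 2).trans h2

end CS

/-! ## §2 The Euler–Lagrange operator is `ℓ²`-controlled by the action at a constrained minimiser -/

section Reg

variable (n : ℕ) [NeZero n] (M : Fin d → ℕ) [hM : ∀ μ, NeZero (M μ)]

omit [NeZero n] hM [InnerProductSpace ℂ E] [CompleteSpace E] in
/-- `QvL T (W − H) = QvL T W − QvL T H`. [folklore] -/
theorem QvL_sub [NormedSpace ℂ E] (T : Tor M → (Fin d → Fin n) → Fin n → Fin d → (E →L[ℂ] E)) (W H : Tor (fine n M) → Fin d → E) :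
    QvL n M T (W - H) = QvL n M T W - QvL n M T H := by
  have h := QvL_add_smul n M T W H (-1)
  rw [neg_one_smul, neg_one_smul, ← sub_eq_add_neg, ← sub_eq_add_neg] at h
  exact h

/-- **LEAF V-REG (Feynman inhabitant), Euler–Lagrange half — END in lattice units**: at a constrained minimiser of `ScV R (landauG 1 R)` on the
fibre `{QvL T W₂ = φ}` (contractive line transports `T`, bond operators `R` arbitrary), for every UB⁺-type constant `Λ`,

  `Σ_{x,ν} ‖((½curl†curl + D div) W)(x,ν)‖² ≤ (Λ∕n^d)·(curlSq W ∕ 2 + divSq W)`. [folklore] -/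
theorem nsqV_elV_le_of_isMin {T : Tor M → (Fin d → Fin n) → Fin n → Fin d → (E →L[ℂ] E)} (hT : ∀ y j t μ, ‖T y j t μ‖ ≤ 1)
    (R : Tor (fine n M) → Fin d → (E →L[ℂ] E)) {Λ : ℝ} (hΛ : 0 ≤ Λ)
    (hUB : ∀ ν : Tor M → Fin d → E, ∃ lam : Tor (fine n M) → Fin d → E, QvL n M T lam = ν ∧
      curlSq (fine n M) R lam / 2 + divSq (fine n M) R lam ≤ Λ * nsqV M ν)
    {φ : Tor M → Fin d → E} {W : Tor (fine n M) → Fin d → E} (hW : QvL n M T W = φ)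
    (hmin : ∀ W₂, QvL n M T W₂ = φ → ScV n M R (landauG (fine n M) 1 R) W ≤ ScV n M R (landauG (fine n M) 1 R) W₂) :
    nsqV (fine n M) (fun x ν => elV (fine n M) R W x ν) ≤ Λ / (n : ℝ) ^ d * (curlSq (fine n M) R W / 2 + divSq (fine n M) R W) := by
  have hn : (0 : ℝ) < (n : ℝ) ^ d := by have := NeZero.ne n; positivity
  set P : Tor (fine n M) → Fin d → E := fun x ν => elV (fine n M) R W x ν with hP
  set m : ℝ := nsqV (fine n M) P with hm
  set FW : ℝ := curlSq (fine n M) R W / 2 + divSq (fine n M) R W with hFW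
  have hm0 : 0 ≤ m := nsqV_nonneg _ _
  have hFW0 : 0 ≤ FW := by have := curlSq_nonneg (fine n M) R W; have := divSq_nonneg (fine n M) R W; positivity
  -- the competitor for the datum `QvL T P`, and the kernel test field `P − λ`
  obtain ⟨lam, hlam, hlamb⟩ := hUB (QvL n M T P)
  have hker : QvL n M T (P - lam) = 0 := by rw [QvL_sub, hlam, sub_self]
  have h0 : ipvV (fine n M) (P - lam) P = 0 := ipvV_elV_eq_zero_of_isMin n M T R hW hmin hker
  -- `Σ‖P‖² = ⟨λ, P⟩ = bformV λ W`
  have key : ((m : ℝ) : ℂ) = bformV (fine n M) R lam W := by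
    rw [ipvV_sub_left, sub_eq_zero, ipvV_self] at h0
    rw [hm, h0, hP, ipvV_elV]
  have hnorm : m = ‖bformV (fine n M) R lam W‖ := by
    rw [← key, Complex.norm_real, Real.norm_of_nonneg hm0]
  -- sizes: Cauchy–Schwarz, the UB⁺ bound, the contraction of the average
  have hF0 : 0 ≤ curlSq (fine n M) R lam / 2 + divSq (fine n M) R lam := by
    have := curlSq_nonneg (fine n M) R lam; have := divSq_nonneg (fine n M) R lam; positivity
  have havg : nsqV M (QvL n M T P) ≤ ((n : ℝ) ^ d)⁻¹ * m := nsqV_QvL_le_qWV n M hT P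
  have hsq : m ^ 2 ≤ Λ * (((n : ℝ) ^ d)⁻¹ * m) * FW := by
    calc m ^ 2 = ‖bformV (fine n M) R lam W‖ ^ 2 := by rw [hnorm]
      _ ≤ (curlSq (fine n M) R lam / 2 + divSq (fine n M) R lam) * FW := norm_bformV_sq_le (fine n M) R lam W
      _ ≤ Λ * nsqV M (QvL n M T P) * FW := mul_le_mul_of_nonneg_right hlamb hFW0
      _ ≤ Λ * (((n : ℝ) ^ d)⁻¹ * m) * FW := mul_le_mul_of_nonneg_right (mul_le_mul_of_nonneg_left havg hΛ) hFW0
  rcases eq_or_lt_of_le hm0 with h0' | hpos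
  · rw [← h0']; positivity
  · have h3 : m * m ≤ Λ / (n : ℝ) ^ d * FW * m := by
      rw [div_eq_mul_inv]; nlinarith [hsq]
    exact le_of_mul_le_mul_right h3 hpos

end Reg

end Summit.QuantumFields.BalabanUV.T4Continuum.VariationalVectorFeynmanRegularity

end
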